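import Literature.Computability.AlgebraicComplexity.MatrixMultiplicationExponent

/-!
# Lower bounds for the rank of `n × n` matrix multiplication (route BorderRankLowerBound)

Named facts (no proofs), stated with `Literature.Computability.AlgebraicComplexity.tensorRank` / `Literature.Computability.AlgebraicComplexity.matMulTensor`:

* `Literature.Computability.AlgebraicComplexity.Blaser1999_rank_lower_bound`: `R(⟨n,n,n⟩) ≥ (5/2) n² − 3n` over an arbitrary field
  (Bläser, FOCS 1999; quoted as "the previous bound" in Landsberg 2014, p.1, and in
  Massarenti–Raviolo 2013, abstract).
* `Literature.Computability.AlgebraicComplexity.Landsberg2014_thm_1_2`: over `ℂ`, for every natural `1 ≤ p ≤ n − 1`,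
  `R(⟨n,n,n⟩) ≥ (3 − 1/(p+1)) n² − (1 + 2p·binom(2p, p−1)) n`; in particular `R ≥ 3n² − o(n²)`
  (Landsberg, *New lower bounds for the rank of matrix multiplication*, SIAM J. Comput. 43 (2014),
  arXiv:1206.1530v2, Theorem 1.2 p.1; "I work over the complex numbers throughout", p.2).

Not vendored here: border-rank bounds (Landsberg–Michałek 2018, `bR ≥ 2n² − ⌈log₂ n⌉ − 1`) which
need the `borderRank` definition (in review), and the rank-method barrier of
Efremenko–Garg–Oliveira–Wigderson 2018, Thm 4.4 (needs the notion of a rank method).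

## Conventions
The real-valued bound is compared with the natural-number rank cast to `ℝ`; `p − 1` is natural
subtraction (harmless since `1 ≤ p`).
-/

namespace Literature.Computability.AlgebraicComplexity

/-- **Bläser 1999**: over any field `K`, `R(⟨n,n,n⟩) ≥ (5/2)·n² − 3n` (M. Bläser, *A 5/2 n²-lower bound
for the rank of n×n-matrix multiplication over arbitrary fields*, FOCS 1999, 45–50, main theorem;
quoted in Landsberg 2014 p.1). [cite: Blaser1999, main theorem] [cite: Landsberg2014, p.1] -/
def Blaser1999_rank_lower_bound : Prop :=
  ∀ (K : Type) [Field K] (n : ℕ),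
    (5 / 2 : ℝ) * (n : ℝ) ^ 2 - 3 * n ≤ (tensorRank (matMulTensor K n n n) : ℝ)

/-- **Landsberg 2014, Theorem 1.2** (over `ℂ`): for every natural number `p` with `1 ≤ p ≤ n − 1`,
`R(M⟨n,n,n⟩) ≥ (3 − 1/(p+1)) n² − (1 + 2p·binom(2p, p−1)) n`. In particular
`R(M⟨n,n,n⟩) ≥ 3n² − o(n²)` (take `p = ⌊√(log n)⌋`). [cite: Landsberg2014, Thm 1.2] -/
def Landsberg2014_thm_1_2 : Prop :=
  ∀ n p : ℕ, 1 ≤ p → p ≤ n - 1 →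
    (3 - 1 / ((p : ℝ) + 1)) * (n : ℝ) ^ 2 - (1 + 2 * (p : ℝ) * (Nat.choose (2 * p) (p - 1) : ℝ)) * n ≤
      (tensorRank (matMulTensor ℂ n n n) : ℝ)

end Literature.Computability.AlgebraicComplexity
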